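import Summits.CriticalPhenomena.Ising3DConformalLimit.Theses.FKParityRobustness
import Summits.CriticalPhenomena.Ising3DConformalLimit.Theorems.FKParityRobustnessIndependentStrandsJoinLimitDictionary
import Summits.CriticalPhenomena.Ising3DConformalLimit.Theorems.HyperoctahedralRPInversionUpgradeNormalisedLatticeRP
import Summits.CriticalPhenomena.Ising3DConformalLimit.Theorems.MoebiusLimitExists.Negative.FreePermutations
import Literature.Probability.LatticeModels.HighDimPointwiseTriviality
import Literature.Probability.LatticeModels.CriticalTwoPointLower
import Literature.Probability.LatticeModels.CriticalBlockMoments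
import HarnessLib

/-!
# Route `FKParityRobustness`, crux `IndependentStrandsJoin` (stmt-CriticalPhenomena-14625), line `pinch-to-tetra` r6:
# the REFLECTION-POSITIVITY SHAPE TRANSFER rectangle → tetrahedron (registered sub-goal `stub_rectTransfer`)

Lead `prover-line-stmt-CriticalPhenomena-14625-c6-0` (2026-08-17).  Theorem-only file (no definitions).

## Statement

Let `A_l = l·tetra`, `tetra = ((−1,−1,−1),(1,1,−1),(1,−1,1),(−1,1,1))`, be the dilated regular tetrahedron of the crux
and `R_l = l·rect`, `rect = ((−1,−1,−1),(1,1,−1),(−1,−1,1),(1,1,1))`, the `2l × 2√2·l` RECTANGLE standing on the same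
bottom edge (a concyclic configuration, cross-ratio `z = 1/3` on the real line).  In the critical infinite-volume state
`criticalCorr 3` of `ℤ³`:

* `criticalCorr_tetra_le_rect` : `⟨σσσσ⟩(A_l) ≤ ⟨σσσσ⟩(R_l)` for every `l : ℕ`;
* `U4crit_le_rect` : `U₄crit(A_l) ≤ ⟨σσσσ⟩(R_l) − 3·⟨σ_{la₀}σ_{la₁}⟩⟨σ_{la₂}σ_{la₃}⟩` (`= S₄(R_l) − 3·τ_d(l)²`,
  `τ_d(l) = ⟨σ₀σ_{(2l,2l,0)}⟩`: all six pair correlations of the regular tetrahedron equal `τ_d(l)` by the signed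
  coordinate permutations of `ℤ³`);
* `tetraMergingEventually_of_rectDominance` : if eventually `⟨σσσσ⟩(R_l) ≤ (3 − c)·⟨σσ⟩⟨σσ⟩(A_l)` for some `c > 0`
  ("RectDominance", the registered stub `stub_rectDominance` of the skeleton r6), then `TetraMergingEventually`
  (far merging at the regular tetrahedra), whence the crux under `LimitExists` by the landed limit upgrade.

## Proof

Reflection positivity of `criticalCorr 3` through the SITE plane `{k₂ = 0}` in Gram form (tree theorem
`stub_latticeRP`: `0 ≤ Σ_{a,b} c_a c_b ⟨∏ σ_{θ z^a} ∏ σ_{z^b}⟩_{β_c}` for configurations in the closed half-lattice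
`{k₂ ≥ 0}`, `θ` the negation of the third coordinate; FILS 1978 §2) applied to the two pairs
`P = ((−l,−l,l),(l,l,l))`, `P′ = ((l,−l,l),(−l,l,l))` with coefficients `(1, −1)`:
`⟨θP,P′⟩ + ⟨θP′,P⟩ ≤ ⟨θP,P⟩ + ⟨θP′,P′⟩` (`criticalCorr_mirror_pair_le`).  Here `θP ++ P′ = A_l` on the nose,
`θP′ ++ P` is the centrally inverted tetrahedron (same correlator by `x ↦ −x` and relabelling), `θP ++ P = R_l`, and
`θP′ ++ P′` is the image of `R_l` under the sign change of the first coordinate; the hyperoctahedral invariance of the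
critical state (`criticalCorr_signedPerm`) identifies the entries, giving `2·S₄(A_l) ≤ 2·S₄(R_l)`.  The Ursell bound is
this plus the identification of the three Wick products at the regular tetrahedron with `τ_d(l)²`
(`criticalCorr_two_pair`, `twoPointPlus_signedPerm`).

Numerically (conformal bootstrap, Rychkov–Simmons-Duffin–Zan 2017 data; this seat's MC kit jobs `rect-tetra-*`):
`S₄(R_l)/τ_d² → Q(1/3)·(1 + 2^{2Δ} + (2/3)^{2Δ}) ≈ 0.73·3.71 = 2.71 < 3`, `S₄(A_l)/τ_d² → 3·Q_min = 2.05`; so the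
transfer certifies `R₄(A_l) = −U₄/GG ≥ 3 − 2.71 ≈ 0.3` of the true `0.95`.

References: J. Fröhlich, R. Israel, E. H. Lieb, B. Simon, Comm. Math. Phys. 62 (1978) §2 [FILS1978]; S. Friedli,
Y. Velenik, *Statistical Mechanics of Lattice Systems* (2017) Lemma 10.8, Exercise 3.14 [FriedliVelenik2017];
S. Rychkov, D. Simmons-Duffin, B. Zan, SciPost Phys. 2 (2017) 001, arXiv:1612.02436 [RychkovSimmonsDuffinZan2017].
-/

noncomputable section

open Filter Topology Finset
open Literature.Probability.LatticeModels
open Summit.CriticalPhenomena.Ising3DConformalLimit.Theses.FKParityRobustness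
open Summit.CriticalPhenomena.Ising3DConformalLimit.Cruxes.ParityRobustMerging.PlaquetteXorSurgery (tetra)
open Summit.CriticalPhenomena.Ising3DConformalLimit.Cruxes.InversionUpgradeNormalised.FreeEndpointGaussianClosure
  (stub_latticeRP)
open Summit.CriticalPhenomena.Ising3DConformalLimit.MoebiusLimitExistsNegative (criticalCorr_signedPerm)

namespace Summit.CriticalPhenomena.Ising3DConformalLimit.Cruxes.IndependentStrandsJoin.PinchToTetra

/-! ### Reflection positivity with two vectors: the pair inequality -/

/-- **Site-mirror reflection positivity, two-vector form.**  For two configurations `P, P′` of `n` sites in the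
closed half-lattice `{k_τ ≥ 0}` of `ℤ³` and `θ` the sign change of the coordinate `τ`,
`⟨∏σ_{θP} ∏σ_{P′}⟩ + ⟨∏σ_{θP′} ∏σ_P⟩ ≤ ⟨∏σ_{θP} ∏σ_P⟩ + ⟨∏σ_{θP′} ∏σ_{P′}⟩` in the critical state: the Gram form of
`stub_latticeRP` (FILS 1978 §2) on the vector `(1, −1)`. -/
theorem criticalCorr_mirror_pair_le (τ : Fin 3) {n : ℕ} (P P' : Fin n → Site 3)
    (hP : ∀ i, 0 ≤ P i τ) (hP' : ∀ i, 0 ≤ P' i τ) :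
    criticalCorr 3 (n + n) (Fin.append (fun i => Function.update (P i) τ (-(P i τ))) P') +
        criticalCorr 3 (n + n) (Fin.append (fun i => Function.update (P' i) τ (-(P' i τ))) P) ≤
      criticalCorr 3 (n + n) (Fin.append (fun i => Function.update (P i) τ (-(P i τ))) P) +
        criticalCorr 3 (n + n) (Fin.append (fun i => Function.update (P' i) τ (-(P' i τ))) P') := by
  have h := stub_latticeRP τ 2 (fun _ => n) ![P, P'] ![1, -1] (by
    intro a i
    fin_cases a
    · exact hP i
    · exact hP' i)
  simp only [Fin.sum_univ_two, Matrix.cons_val_zero, Matrix.cons_val_one] at h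
  linarith

/-! ### The tetrahedral geometry -/

/-- `θP ++ P′ = l·tetra` exactly, for `P = ((−l,−l,l),(l,l,l))`, `P′ = ((l,−l,l),(−l,l,l))`. -/
theorem mirror_upper_append_cross (l : ℕ) :
    Fin.append (fun i => Function.update ((![![-(l : ℤ), -l, l], ![(l : ℤ), l, l]] : Fin 2 → Site 3) i) 2
        (-((![![-(l : ℤ), -l, l], ![(l : ℤ), l, l]] : Fin 2 → Site 3) i 2)))
      (![![(l : ℤ), -l, l], ![-(l : ℤ), l, l]] : Fin 2 → Site 3) = fun i => (l : ℤ) • tetra i := by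
  funext i
  refine Fin.addCases (fun j => ?_) (fun j => ?_) i
  · rw [Fin.append_left]
    fin_cases j <;> (funext k; fin_cases k <;> simp [tetra])
  · rw [Fin.append_right]
    fin_cases j <;> (funext k; fin_cases k <;> simp [tetra])

/-- `θP ++ P = l·rect`. -/
theorem mirror_upper_append_self (l : ℕ) :
    Fin.append (fun i => Function.update ((![![-(l : ℤ), -l, l], ![(l : ℤ), l, l]] : Fin 2 → Site 3) i) 2
        (-((![![-(l : ℤ), -l, l], ![(l : ℤ), l, l]] : Fin 2 → Site 3) i 2)))
      (![![-(l : ℤ), -l, l], ![(l : ℤ), l, l]] : Fin 2 → Site 3) =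
      fun i => (l : ℤ) • (![![-1, -1, -1], ![1, 1, -1], ![-1, -1, 1], ![1, 1, 1]] : Fin 4 → Site 3) i := by
  funext i
  refine Fin.addCases (fun j => ?_) (fun j => ?_) i
  · rw [Fin.append_left]
    fin_cases j <;> (funext k; fin_cases k <;> simp)
  · rw [Fin.append_right]
    fin_cases j <;> (funext k; fin_cases k <;> simp)

/-- `θP′ ++ P` is the centrally inverted tetrahedron, relabelled by `Fin.rev`. -/
theorem mirror_cross_append_upper (l : ℕ) :
    Fin.append (fun i => Function.update ((![![(l : ℤ), -l, l], ![-(l : ℤ), l, l]] : Fin 2 → Site 3) i) 2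
        (-((![![(l : ℤ), -l, l], ![-(l : ℤ), l, l]] : Fin 2 → Site 3) i 2)))
      (![![-(l : ℤ), -l, l], ![(l : ℤ), l, l]] : Fin 2 → Site 3) =
      (fun i => Site.signedPerm (Equiv.refl (Fin 3)) (fun _ => -1) ((l : ℤ) • tetra i)) ∘ ⇑(Fin.revPerm) := by
  funext i
  refine Fin.addCases (fun j => ?_) (fun j => ?_) i
  · rw [Fin.append_left]
    fin_cases j <;> (funext k; fin_cases k <;> simp [tetra, Fin.rev])
  · rw [Fin.append_right]
    fin_cases j <;> (funext k; fin_cases k <;> simp [tetra, Fin.rev])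

/-- `θP′ ++ P′` is the image of `l·rect` under the sign change of the first coordinate. -/
theorem mirror_cross_append_self (l : ℕ) :
    Fin.append (fun i => Function.update ((![![(l : ℤ), -l, l], ![-(l : ℤ), l, l]] : Fin 2 → Site 3) i) 2
        (-((![![(l : ℤ), -l, l], ![-(l : ℤ), l, l]] : Fin 2 → Site 3) i 2)))
      (![![(l : ℤ), -l, l], ![-(l : ℤ), l, l]] : Fin 2 → Site 3) =
      fun i => Site.signedPerm (Equiv.refl (Fin 3)) (Function.update 1 0 (-1))
        ((l : ℤ) • (![![-1, -1, -1], ![1, 1, -1], ![-1, -1, 1], ![1, 1, 1]] : Fin 4 → Site 3) i) := by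
  funext i
  refine Fin.addCases (fun j => ?_) (fun j => ?_) i
  · rw [Fin.append_left]
    fin_cases j <;> (funext k; fin_cases k <;> simp)
  · rw [Fin.append_right]
    fin_cases j <;> (funext k; fin_cases k <;> simp)


/-! ### The shape transfer `S₄(l·tetra) ≤ S₄(l·rect)` -/

/-- **Reflection positivity transfers the four-point function from the RP-diagonal rectangle to the regular
tetrahedron**: `⟨σσσσ⟩_{β_c}(l·tetra) ≤ ⟨σσσσ⟩_{β_c}(l·rect)` for every `l : ℕ`, `rect = ((−1,−1,−1),(1,1,−1),
(−1,−1,1),(1,1,1))` the `2 × 2√2` rectangle on the tetrahedron's bottom edge (FILS 1978 §2 site-mirror positivity on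
the vector `σ_P − σ_{P′}`, hyperoctahedral invariance of the critical state). -/
theorem criticalCorr_tetra_le_rect (l : ℕ) :
    criticalCorr 3 4 (fun i => (l : ℤ) • tetra i) ≤
      criticalCorr 3 4 (fun i => (l : ℤ) • (![![-1, -1, -1], ![1, 1, -1], ![-1, -1, 1], ![1, 1, 1]] : Fin 4 → Site 3) i) := by
  have h := criticalCorr_mirror_pair_le 2 (![![-(l : ℤ), -l, l], ![(l : ℤ), l, l]] : Fin 2 → Site 3)
    (![![(l : ℤ), -l, l], ![-(l : ℤ), l, l]] : Fin 2 → Site 3)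
    (by intro i; fin_cases i <;> simp) (by intro i; fin_cases i <;> simp)
  rw [mirror_upper_append_cross, mirror_upper_append_self, mirror_cross_append_upper, mirror_cross_append_self,
    criticalCorr_comp_equiv_eq, criticalCorr_signedPerm, criticalCorr_signedPerm] at h
  linarith

/-! ### The Ursell form: the six pair correlations of the regular tetrahedron -/

/-- A pair correlation whose difference vector is a signed coordinate permutation of `(2l,2l,0)` equals
`τ_d(l) = ⟨σ₀σ_{(2l,2l,0)}⟩_{β_c}` (translation invariance `criticalCorr_two_pair` + hyperoctahedral invariance of the
two-point function `twoPointPlus_signedPerm`). -/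
theorem criticalCorr_pair_eq_tauD (l : ℕ) {a b : Site 3} (π : Equiv.Perm (Fin 3)) (ε : Fin 3 → ℤˣ)
    (h : b - a = Site.signedPerm π ε ((l : ℤ) • (![2, 2, 0] : Site 3))) :
    criticalCorr 3 2 ![a, b] = criticalTwoPoint 3 ((l : ℤ) • (![2, 2, 0] : Site 3)) := by
  rw [criticalCorr_two_pair, h]
  exact twoPointPlus_signedPerm _ _ _ _

/-- `⟨σ_{la₀}σ_{la₁}⟩ = τ_d(l)`. -/
theorem pair01_eq (l : ℕ) :
    criticalCorr 3 2 ![(l : ℤ) • tetra 0, (l : ℤ) • tetra 1] = criticalTwoPoint 3 ((l : ℤ) • (![2, 2, 0] : Site 3)) :=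
  criticalCorr_pair_eq_tauD l (Equiv.refl _) 1 (by funext k; fin_cases k <;> simp [tetra] <;> ring)

/-- `⟨σ_{la₂}σ_{la₃}⟩ = τ_d(l)`. -/
theorem pair23_eq (l : ℕ) :
    criticalCorr 3 2 ![(l : ℤ) • tetra 2, (l : ℤ) • tetra 3] = criticalTwoPoint 3 ((l : ℤ) • (![2, 2, 0] : Site 3)) :=
  criticalCorr_pair_eq_tauD l (Equiv.refl _) (Function.update 1 0 (-1))
    (by funext k; fin_cases k <;> simp [tetra] <;> ring)

/-- `⟨σ_{la₀}σ_{la₂}⟩ = τ_d(l)`. -/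
theorem pair02_eq (l : ℕ) :
    criticalCorr 3 2 ![(l : ℤ) • tetra 0, (l : ℤ) • tetra 2] = criticalTwoPoint 3 ((l : ℤ) • (![2, 2, 0] : Site 3)) :=
  criticalCorr_pair_eq_tauD l (Equiv.swap 1 2) 1
    (by funext k; fin_cases k <;> simp [tetra, Equiv.swap_apply_of_ne_of_ne] <;> ring)

/-- `⟨σ_{la₁}σ_{la₃}⟩ = τ_d(l)`. -/
theorem pair13_eq (l : ℕ) :
    criticalCorr 3 2 ![(l : ℤ) • tetra 1, (l : ℤ) • tetra 3] = criticalTwoPoint 3 ((l : ℤ) • (![2, 2, 0] : Site 3)) :=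
  criticalCorr_pair_eq_tauD l (Equiv.swap 1 2) (Function.update 1 0 (-1))
    (by funext k; fin_cases k <;> simp [tetra, Equiv.swap_apply_of_ne_of_ne] <;> ring)

/-- `⟨σ_{la₀}σ_{la₃}⟩ = τ_d(l)`. -/
theorem pair03_eq (l : ℕ) :
    criticalCorr 3 2 ![(l : ℤ) • tetra 0, (l : ℤ) • tetra 3] = criticalTwoPoint 3 ((l : ℤ) • (![2, 2, 0] : Site 3)) :=
  criticalCorr_pair_eq_tauD l (Equiv.swap 0 2) 1
    (by funext k; fin_cases k <;> simp [tetra, Equiv.swap_apply_of_ne_of_ne] <;> ring)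

/-- `⟨σ_{la₁}σ_{la₂}⟩ = τ_d(l)`. -/
theorem pair12_eq (l : ℕ) :
    criticalCorr 3 2 ![(l : ℤ) • tetra 1, (l : ℤ) • tetra 2] = criticalTwoPoint 3 ((l : ℤ) • (![2, 2, 0] : Site 3)) :=
  criticalCorr_pair_eq_tauD l (Equiv.swap 0 2) (Function.update 1 1 (-1))
    (by funext k; fin_cases k <;> simp [tetra, Equiv.swap_apply_of_ne_of_ne] <;> ring)

/-- Aizenman's normalisation at the regular tetrahedron is `τ_d(l)²`: `⟨σ_{la₀}σ_{la₁}⟩⟨σ_{la₂}σ_{la₃}⟩ = τ_d(l)²`. -/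
theorem GGcrit_eq_tauD_sq (l : ℕ) : GGcrit l = criticalTwoPoint 3 ((l : ℤ) • (![2, 2, 0] : Site 3)) ^ 2 := by
  unfold GGcrit
  rw [pair01_eq, pair23_eq, sq]

/-- The Wick (Gaussian) part at the regular tetrahedron is `3·τ_d(l)² = 3·GG`. -/
theorem wick_tetra_eq (l : ℕ) :
    criticalCorr 3 2 ![(l : ℤ) • tetra 0, (l : ℤ) • tetra 1] * criticalCorr 3 2 ![(l : ℤ) • tetra 2, (l : ℤ) • tetra 3] +
        criticalCorr 3 2 ![(l : ℤ) • tetra 0, (l : ℤ) • tetra 2] * criticalCorr 3 2 ![(l : ℤ) • tetra 1, (l : ℤ) • tetra 3] +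
        criticalCorr 3 2 ![(l : ℤ) • tetra 0, (l : ℤ) • tetra 3] * criticalCorr 3 2 ![(l : ℤ) • tetra 1, (l : ℤ) • tetra 2] =
      3 * GGcrit l := by
  unfold GGcrit
  rw [pair01_eq, pair23_eq, pair02_eq, pair13_eq, pair03_eq, pair12_eq]
  ring

/-- **The Ursell form of the transfer**: `U₄crit(l·tetra) ≤ ⟨σσσσ⟩(l·rect) − 3·⟨σσ⟩⟨σσ⟩(l·tetra)`, i.e. in Aizenman's
normalisation `R₄(A_l) = −U₄/GG ≥ 3 − S₄(l·rect)/GG`. -/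
theorem U4crit_le_rect (l : ℕ) :
    U4crit l ≤ criticalCorr 3 4 (fun i => (l : ℤ) •
        (![![-1, -1, -1], ![1, 1, -1], ![-1, -1, 1], ![1, 1, 1]] : Fin 4 → Site 3) i) - 3 * GGcrit l := by
  have h := criticalCorr_tetra_le_rect l
  have hw := wick_tetra_eq l
  unfold U4crit
  linarith

/-! ### The reduction: RectDominance ⟹ tetrahedral far merging -/

/-- **RectDominance ⟹ TetraMergingEventually.**  If for some `c > 0` and all large `l` the critical four-point
function of the `2l × 2√2·l` rectangle is at most `(3 − c)·⟨σσ⟩⟨σσ⟩(l·tetra)` (= `(3 − c)·τ_d(l)²`), then the regular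
tetrahedra merge far: `U₄crit(l·tetra) ≤ −c·⟨σσ⟩⟨σσ⟩` eventually. -/
theorem tetraMergingEventually_of_rectDominance
    (h : ∃ c : ℝ, 0 < c ∧ ∃ l₁ : ℕ, ∀ l : ℕ, l₁ ≤ l →
      criticalCorr 3 4 (fun i => (l : ℤ) •
          (![![-1, -1, -1], ![1, 1, -1], ![-1, -1, 1], ![1, 1, 1]] : Fin 4 → Site 3) i) ≤ (3 - c) * GGcrit l) :
    TetraMergingEventually := by
  obtain ⟨c, hc, l₁, hl⟩ := h
  refine ⟨c, hc, l₁, fun l hll => ?_⟩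
  have h1 := U4crit_le_rect l
  have h2 := hl l hll
  have h3 : (3 - c) * GGcrit l = 3 * GGcrit l - c * GGcrit l := by ring
  linarith

/-- Conversely the transfer is one-way: tetrahedral far merging gives only `S₄(l·tetra) ≤ (3 − c)·GG`, which is the
SAME inequality at the off-diagonal entry; nothing is claimed about the rectangle (RectDominance overshoots the crux). -/
theorem criticalCorr_tetra_le_of_tetraMerging {c : ℝ} {l : ℕ} (h : U4crit l ≤ -(c * GGcrit l)) :
    criticalCorr 3 4 (fun i => (l : ℤ) • tetra i) ≤ (3 - c) * GGcrit l := by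
  have hw := wick_tetra_eq l
  unfold U4crit at h
  linarith

end Summit.CriticalPhenomena.Ising3DConformalLimit.Cruxes.IndependentStrandsJoin.PinchToTetra

/-! ## The registered sub-goal `stub_rectTransfer` (crux stmt-CriticalPhenomena-14625, line `pinch-to-tetra` r6) -/

namespace Summit.CriticalPhenomena.Ising3DConformalLimit.Theorems

open Summit.CriticalPhenomena.Ising3DConformalLimit.Cruxes.IndependentStrandsJoin.PinchToTetra

/-- **stub_rectTransfer** (lead c6-0, line `pinch-to-tetra` r6): (i) the reflection-positivity shape transfer
`⟨σσσσ⟩_{β_c}(l·tetra) ≤ ⟨σσσσ⟩_{β_c}(l·rect)` for every `l`; (ii) its Ursell form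
`U₄crit(l·tetra) ≤ ⟨σσσσ⟩(l·rect) − 3·GG`; (iii) RectDominance ⟹ TetraMergingEventually. -/
theorem stub_rectTransfer :
    (∀ l : ℕ, criticalCorr 3 4 (fun i => (l : ℤ) •
        (![![-1, -1, -1], ![1, 1, -1], ![1, -1, 1], ![-1, 1, 1]] : Fin 4 → Site 3) i) ≤
      criticalCorr 3 4 (fun i => (l : ℤ) •
        (![![-1, -1, -1], ![1, 1, -1], ![-1, -1, 1], ![1, 1, 1]] : Fin 4 → Site 3) i)) ∧
    (∀ l : ℕ, U4crit l ≤ criticalCorr 3 4 (fun i => (l : ℤ) •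
        (![![-1, -1, -1], ![1, 1, -1], ![-1, -1, 1], ![1, 1, 1]] : Fin 4 → Site 3) i) - 3 * GGcrit l) ∧
    ((∃ c : ℝ, 0 < c ∧ ∃ l₁ : ℕ, ∀ l : ℕ, l₁ ≤ l →
        criticalCorr 3 4 (fun i => (l : ℤ) •
          (![![-1, -1, -1], ![1, 1, -1], ![-1, -1, 1], ![1, 1, 1]] : Fin 4 → Site 3) i) ≤ (3 - c) * GGcrit l) →
      TetraMergingEventually) :=
  ⟨criticalCorr_tetra_le_rect, U4crit_le_rect, tetraMergingEventually_of_rectDominance⟩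

end Summit.CriticalPhenomena.Ising3DConformalLimit.Theorems
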